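import Mathlib
import HarnessLib

/-!
# The regrouping of the forest formula for NON-COMMUTING, ORDERED subtraction operators (Zimmermann 1969 Theorem 4.3, eqs. (4.22)–(4.26), with the operator ordering of AHKN's K-operation forest formula, AKN 2019 §4.6) — PROVED, as an identity of ordered products in an arbitrary ring

HONEST FRAMING (venture `QEDPrecision`, cell `qed-hepp`, seat `qed-hepp-lit` gen 0; VALUE-FREE: finite combinatorics of Boolean intervals of finite
sets and identities between ORDERED products of ring elements; no graph, no integral, nothing per Set-V family). Companion of
`Zimmermann1969/ForestFormulaRegrouping.lean` (same seat, same day; proposal p396294), which types Zimmermann's forests and proves the regrouping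
`Σ_{U∈𝓕} Π_{γ∈U} (−t_γ) = Σ_{classes} Π_{bot}(−t_γ) Π_{top∖bot}(1 − t_γ)` for COMMUTING symbols `t_γ` (the α-parametric situation of Bergère–Zuber).
The cell's scheme (SCHEME-SETV = AHKN K-forests) composes K-OPERATORS, which do not commute when nested — AKN 2019 §4.6, VERBATIM (held
`paper:doi-10-3390-atoms7010028`, chunks p0016–p0017): «1. disjoint: S_α ∩ S_β = ∅ … K_α and K_β are commutable. 2. inclusion: S_α ⊂ S_β … K_α and K_β
are not commutable. K_β must be applied first, and then, K_α. 3. overlapping … The operations K_α K_β and K_β K_α are null.»; AHKN 2015 eq. (27) (held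
`paper:arxiv-1412.8284`, chunk p0011): «M_G^R = Σ_{f∈𝔉(G)} [Π_{S_i∈f} (−K_{S_i})] M_G, (27) where the sum is taken over all forests f, including an empty
forest … The order of operation in the product is arranged so that operations for the outer subdiagrams are applied first.» Zimmermann's own
momentum-space `t^γ` are likewise ordered (his (4.22)–(4.26) are products taken along the inclusion order). THIS file therefore re-proves the class
evaluation and the regrouping WITHOUT commutativity: every product is taken along one fixed enumeration `l : List β` of the operators (e.g. «outer
subdiagrams first»), restricted to the members of each forest. Only DISTRIBUTIVITY is used — exactly what the printed proof of Theorem 4.3 uses («This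
partition of the set of all forests into equivalence classes leads to the following formula … X_C = S_Γ Σ_{C̲⊆U⊆C} Π(−t^γ S_γ) I_Γ(U) (4.26)» and
(4.22)/(4.24): «R_Γ = S_Γ Σ_{U∈𝒞} Π_{γ∈U} f(γ) S_γ I_Γ(U) … f(γ) = 1 − t^γ if γ ∈ 𝓔(U), f(γ) = −t^γ if γ ∉ 𝓔(U)»;
[Zimmermann1969] = Commun. Math. Phys. 15 (1969) 208, held `paper:doi-10-1007-bf01645676`, p0020:L18–p0021:L10).

TYPING. `orderedNegProd l t U = Π_{γ ∈ l, γ ∈ U} (−t γ)` (list order of `l`, factors restricted to `U`) is one forest term `Π_{S∈f}(−K_S)` of (27) read as a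
ring element (operators under composition form a ring; the cell may also read `t γ` as commuting functions, recovering the companion file);
`orderedClassProd l t B C = Π_{γ ∈ l, γ ∈ C} f(γ)` with `f(γ) = −t γ` on `B` and `1 − t γ` on `C ∖ B` is Zimmermann's `Π_{γ∈C} f(γ)` of (4.22)/(4.24)
in the same order. PROVED: `sum_Icc_orderedNegProd_eq` — for `l` duplicate-free and `B ⊆ C ⊆ l.toFinset`,
`Σ_{B ⊆ U ⊆ C} orderedNegProd l t U = orderedClassProd l t B C` ((4.26) ⇒ the `C`-term of (4.22), by induction on `l`: each operator of `C ∖ B` is either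
skipped or taken, `1 + (−t) = 1 − t`); and `sum_orderedNegProd_eq_sum_fixed_of_interval_fibres` — the regrouped forest formula for any idempotent
classification map with Boolean-interval fibres (the printed content of Theorem 4.2 / Rivasseau's Lemma II.3.2 (II.3.12b)), ordered version of the
companion file's `sum_prod_neg_eq_sum_fixed_of_interval_fibres`. NOT typed: that the K-operators of SCHEME-SETV satisfy AKN's rules 1–3 (the cell's
code is the definition of record), and the construction of the classification from a Hepp sector (theory seat).
-/

namespace Literature.MathematicalPhysics.QuantumFieldTheory.Zimmermann1969

open Finset

variable {β : Type*} [DecidableEq β] {R : Type*} [Ring R]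

/-- One forest term with ORDERED, non-commuting subtraction operators: the product of `−t γ` over the members `γ ∈ U`, taken in the order of
the fixed enumeration `l` («The order of operation in the product is arranged so that operations for the outer subdiagrams are applied first»).
[cite: AoyamaEtAl2015, eq. (27)] -/
def orderedNegProd (l : List β) (t : β → R) (U : Finset β) : R :=
  ((l.filter (· ∈ U)).map fun γ => -t γ).prod

/-- Zimmermann's regrouped class product `Π_{γ∈C} f(γ)` with `f(γ) = −t^γ` for `γ` in the base `B` and `f(γ) = 1 − t^γ` for `γ ∈ 𝓔 = C ∖ B`,
taken in the order of `l`. [cite: Zimmermann1969, Theorem 4.3 eqs. (4.22), (4.24)] -/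
def orderedClassProd (l : List β) (t : β → R) (B C : Finset β) : R :=
  ((l.filter (· ∈ C)).map fun γ => if γ ∈ B then -t γ else 1 - t γ).prod

/-- The empty enumeration gives the empty product. [cite: Zimmermann1969, eq. (3.26) (empty forest)] -/
@[simp] theorem orderedNegProd_nil (t : β → R) (U : Finset β) : orderedNegProd [] t U = 1 := by
  simp [orderedNegProd]

/-- Head step of the ordered forest term: the first operator of the enumeration is applied (leftmost) iff it belongs to the forest.
[cite: AoyamaEtAl2015, eq. (27)] -/
theorem orderedNegProd_cons (a : β) (l : List β) (t : β → R) (U : Finset β) :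
    orderedNegProd (a :: l) t U = if a ∈ U then -t a * orderedNegProd l t U else orderedNegProd l t U := by
  unfold orderedNegProd
  rw [List.filter_cons]
  by_cases ha : a ∈ U
  · simp [ha]
  · simp [ha]

/-- Head step of the class product. [cite: Zimmermann1969, Theorem 4.3 eq. (4.24)] -/
theorem orderedClassProd_cons (a : β) (l : List β) (t : β → R) (B C : Finset β) :
    orderedClassProd (a :: l) t B C =
      if a ∈ C then (if a ∈ B then -t a else 1 - t a) * orderedClassProd l t B C else orderedClassProd l t B C := by
  unfold orderedClassProd
  rw [List.filter_cons]
  by_cases ha : a ∈ C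
  · simp [ha]
  · simp [ha]

/-- The ordered forest term only sees the members of `U` that occur in `l`: inserting an element not in `l` changes nothing.
[cite: AoyamaEtAl2015, eq. (27)] -/
theorem orderedNegProd_insert_of_not_mem {a : β} {l : List β} (ha : a ∉ l) (t : β → R) (U : Finset β) :
    orderedNegProd l t (insert a U) = orderedNegProd l t U := by
  unfold orderedNegProd
  congr 2
  refine List.filter_congr fun x hx => ?_
  have hxa : x ≠ a := fun h => ha (h ▸ hx)
  simp [Finset.mem_insert, hxa]

/-- The class product only sees `B` through its members in `l`: erasing from `B` an element not in `l` changes nothing.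
[cite: Zimmermann1969, Theorem 4.3 eq. (4.24)] -/
theorem orderedClassProd_erase_of_not_mem {a : β} {l : List β} (ha : a ∉ l) (t : β → R) (B C : Finset β) :
    orderedClassProd l t (B.erase a) C = orderedClassProd l t B C := by
  unfold orderedClassProd
  congr 1
  refine List.map_congr_left fun x hx => ?_
  have hxl : x ∈ l := (List.mem_filter.1 hx).1
  have hxa : x ≠ a := fun h => ha (h ▸ hxl)
  simp [Finset.mem_erase, hxa]

/-- The class product ignores members of `C` outside `l`. [cite: Zimmermann1969, Theorem 4.3 eq. (4.24)] -/
theorem orderedClassProd_insert_of_not_mem {a : β} {l : List β} (ha : a ∉ l) (t : β → R) (B C : Finset β) :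
    orderedClassProd l t B (insert a C) = orderedClassProd l t B C := by
  unfold orderedClassProd
  congr 2
  refine List.filter_congr fun x hx => ?_
  have hxa : x ≠ a := fun h => ha (h ▸ hx)
  simp [Finset.mem_insert, hxa]

/-- Boolean-interval bookkeeping, case `a ∉ B`: the forests `U` with `B ⊆ U ⊆ insert a L` are those with `B ⊆ U ⊆ L` together with their
`insert a` images (for `a ∉ L`). [folklore] -/
private theorem Icc_insert_eq_disjUnion {a : β} {B L : Finset β} (haL : a ∉ L) (haB : a ∉ B) :
    ∃ h, Finset.Icc B (insert a L) = (Finset.Icc B L).disjUnion ((Finset.Icc B L).image (insert a)) h := by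
  have hdisj : Disjoint (Finset.Icc B L) ((Finset.Icc B L).image (insert a)) := by
    rw [Finset.disjoint_left]
    intro U hU hU'
    obtain ⟨U', -, rfl⟩ := Finset.mem_image.1 hU'
    exact haL ((Finset.mem_Icc.1 hU).2 (Finset.mem_insert_self a U'))
  refine ⟨hdisj, ?_⟩
  ext U
  rw [Finset.mem_disjUnion, Finset.mem_Icc, Finset.mem_Icc, Finset.mem_image]
  constructor
  · rintro ⟨hBU, hUL⟩
    by_cases haU : a ∈ U
    · refine Or.inr ⟨U.erase a, Finset.mem_Icc.2 ⟨?_, Finset.subset_insert_iff.1 hUL⟩, Finset.insert_erase haU⟩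
      intro x hx
      exact Finset.mem_erase.2 ⟨fun h => haB (h ▸ hx), hBU hx⟩
    · exact Or.inl ⟨hBU, (Finset.subset_insert_iff_of_notMem haU).1 hUL⟩
  · rintro (⟨hBU, hUL⟩ | ⟨U', hU', rfl⟩)
    · exact ⟨hBU, hUL.trans (Finset.subset_insert a L)⟩
    · obtain ⟨hBU', hU'L⟩ := Finset.mem_Icc.1 hU'
      exact ⟨hBU'.trans (Finset.subset_insert a U'), Finset.insert_subset_insert a hU'L⟩

/-- Boolean-interval bookkeeping, case `a ∈ B`: the forests `U` with `B ⊆ U ⊆ insert a L` are the `insert a` images of those with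
`B.erase a ⊆ U′ ⊆ L`. [folklore] -/
private theorem Icc_insert_eq_image_of_mem {a : β} {B L : Finset β} (haB : a ∈ B) :
    Finset.Icc B (insert a L) = (Finset.Icc (B.erase a) L).image (insert a) := by
  ext U
  rw [Finset.mem_Icc, Finset.mem_image]
  constructor
  · rintro ⟨hBU, hUL⟩
    refine ⟨U.erase a, Finset.mem_Icc.2 ⟨Finset.erase_subset_erase a hBU, Finset.subset_insert_iff.1 hUL⟩,
      Finset.insert_erase (hBU haB)⟩
  · rintro ⟨U', hU', rfl⟩
    obtain ⟨hBU', hU'L⟩ := Finset.mem_Icc.1 hU'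
    exact ⟨Finset.subset_insert_iff.2 hBU', Finset.insert_subset_insert a hU'L⟩

/-- `insert a` is injective on families of sets none of which contains `a`. [folklore] -/
private theorem insert_injOn_Icc {a : β} {B L : Finset β} (haL : a ∉ L) :
    Set.InjOn (insert a) (Finset.Icc B L : Set (Finset β)) := by
  intro U₁ hU₁ U₂ hU₂ h
  have h₁ : a ∉ U₁ := fun ha => haL ((Finset.mem_Icc.1 (Finset.mem_coe.1 hU₁)).2 ha)
  have h₂ : a ∉ U₂ := fun ha => haL ((Finset.mem_Icc.1 (Finset.mem_coe.1 hU₂)).2 ha)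
  rw [← Finset.erase_insert h₁, h, Finset.erase_insert h₂]

/-- **One equivalence class of forests, ORDERED operators** (Zimmermann (4.26) ⇒ the `C`-term of (4.22)/(4.24), without commutativity): if `l` is a
duplicate-free enumeration containing `C` and `B ⊆ C`, then summing the ordered forest terms over the Boolean interval `B ⊆ U ⊆ C` gives the single
ordered product with `−t γ` at the places `γ ∈ B` and `1 − t γ` at the places `γ ∈ C ∖ B`. Only distributivity is used.
[cite: Zimmermann1969, Theorem 4.3 proof, eqs. (4.24)–(4.26)] -/
theorem sum_Icc_orderedNegProd_eq (t : β → R) :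
    ∀ (l : List β), l.Nodup → ∀ (B C : Finset β), B ⊆ C → C ⊆ l.toFinset →
      ∑ U ∈ Finset.Icc B C, orderedNegProd l t U = orderedClassProd l t B C := by
  intro l
  induction l with
  | nil =>
    intro _ B C hBC hC
    have hC0 : C = ∅ := Finset.subset_empty.1 (by simpa using hC)
    subst hC0
    have hB0 : B = ∅ := Finset.subset_empty.1 hBC
    subst hB0
    simp [orderedNegProd, orderedClassProd]
  | cons a l ih =>
    intro hnd B C hBC hC
    obtain ⟨hal, hl⟩ := List.nodup_cons.1 hnd
    have haLfin : a ∉ l.toFinset := fun h => hal (List.mem_toFinset.1 h)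
    by_cases haC : a ∈ C
    · -- write C = insert a L with a ∉ L ⊆ l.toFinset
      set L := C.erase a with hLdef
      have haL : a ∉ L := Finset.notMem_erase a C
      have hCL : C = insert a L := (Finset.insert_erase haC).symm
      have hLl : L ⊆ l.toFinset := by
        intro x hx
        obtain ⟨hxa, hxC⟩ := Finset.mem_erase.1 hx
        have := hC hxC
        rw [List.toFinset_cons, Finset.mem_insert] at this
        exact this.resolve_left hxa
      rw [hCL]
      by_cases haB : a ∈ B
      · -- every U in the class contains a: factor (−t a) on the left
        have hB'L : B.erase a ⊆ L := Finset.erase_subset_erase a (hCL ▸ hBC)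
        rw [Icc_insert_eq_image_of_mem haB, Finset.sum_image (insert_injOn_Icc haL)]
        have hstep : ∀ U ∈ Finset.Icc (B.erase a) L,
            orderedNegProd (a :: l) t (insert a U) = -t a * orderedNegProd l t U := by
          intro U _
          rw [orderedNegProd_cons, if_pos (Finset.mem_insert_self a U), orderedNegProd_insert_of_not_mem hal]
        rw [Finset.sum_congr rfl hstep, ← Finset.mul_sum, ih hl (B.erase a) L hB'L hLl,
          orderedClassProd_cons, if_pos (Finset.mem_insert_self a L), if_pos haB,
          orderedClassProd_insert_of_not_mem hal, orderedClassProd_erase_of_not_mem hal]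
      · -- U ranges over the class of L and its insert-a copies: factor (1 − t a)
        have hBL : B ⊆ L := by
          intro x hx
          exact Finset.mem_erase.2 ⟨fun h => haB (h ▸ hx), hBC hx⟩
        obtain ⟨hdisj, hIcc⟩ := Icc_insert_eq_disjUnion (B := B) haL haB
        rw [hIcc, Finset.sum_disjUnion, Finset.sum_image (insert_injOn_Icc haL)]
        have hstep₁ : ∀ U ∈ Finset.Icc B L, orderedNegProd (a :: l) t U = orderedNegProd l t U := by
          intro U hU
          have haU : a ∉ U := fun h => haL ((Finset.mem_Icc.1 hU).2 h)
          rw [orderedNegProd_cons, if_neg haU]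
        have hstep₂ : ∀ U ∈ Finset.Icc B L,
            orderedNegProd (a :: l) t (insert a U) = -t a * orderedNegProd l t U := by
          intro U _
          rw [orderedNegProd_cons, if_pos (Finset.mem_insert_self a U), orderedNegProd_insert_of_not_mem hal]
        rw [Finset.sum_congr rfl hstep₁, Finset.sum_congr rfl hstep₂, ← Finset.mul_sum, ih hl B L hBL hLl,
          orderedClassProd_cons, if_pos (Finset.mem_insert_self a L), if_neg haB,
          orderedClassProd_insert_of_not_mem hal]
        noncomm_ring
    · -- a ∉ C: the head operator never fires
      have hCl : C ⊆ l.toFinset := by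
        intro x hx
        have := hC hx
        rw [List.toFinset_cons, Finset.mem_insert] at this
        exact this.resolve_left fun h => haC (h ▸ hx)
      have hstep : ∀ U ∈ Finset.Icc B C, orderedNegProd (a :: l) t U = orderedNegProd l t U := by
        intro U hU
        have haU : a ∉ U := fun h => haC ((Finset.mem_Icc.1 hU).2 h)
        rw [orderedNegProd_cons, if_neg haU]
      rw [Finset.sum_congr rfl hstep, ih hl B C hBC hCl, orderedClassProd_cons, if_neg haC]

/-- **The regrouped forest formula for ordered, non-commuting operators** (Zimmermann Theorem 4.2 ⇒ Theorem 4.3, resp. Rivasseau Lemma II.3.2 ⇒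
(II.3.19), in AHKN's operator ordering): let `𝓕` be a finite family of finite sets of operators labels (the forests), all contained in the duplicate-free
enumeration `l`; let `key` map `𝓕` into itself idempotently with the class of each fixed point `K` equal to the Boolean interval `[bot K, top K]`
(«the set of all forests U with the completion C is given by the condition B ⊆ U ⊆ C», Theorem 4.2). Then the sum of the ORDERED forest terms equals
the sum over the classes of the ORDERED class products: `Σ_{U∈𝓕} Π^{ord}_{γ∈U}(−t_γ) = Σ_{K = key K} Π^{ord}_{γ ∈ top K} f_K(γ)`, `f_K = −t` on `bot K`,
`1 − t` on `top K ∖ bot K` — eqs. (4.22)–(4.26). [cite: Zimmermann1969, Theorems 4.2–4.3, eqs. (4.21)–(4.26)] -/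
theorem sum_orderedNegProd_eq_sum_fixed_of_interval_fibres (l : List β) (hl : l.Nodup) (𝓕 : Finset (Finset β))
    (h𝓕 : ∀ U ∈ 𝓕, U ⊆ l.toFinset) (key bot top : Finset β → Finset β) (t : β → R)
    (hkey : ∀ U ∈ 𝓕, key U ∈ 𝓕 ∧ key (key U) = key U)
    (hfib : ∀ K ∈ 𝓕, key K = K → bot K ⊆ top K ∧ ∀ U, (U ∈ 𝓕 ∧ key U = K) ↔ U ∈ Finset.Icc (bot K) (top K)) :
    ∑ U ∈ 𝓕, orderedNegProd l t U =
      ∑ K ∈ 𝓕.filter (fun K => key K = K), orderedClassProd l t (bot K) (top K) := by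
  have hmaps : ∀ U ∈ 𝓕, key U ∈ 𝓕.filter (fun K => key K = K) := fun U hU =>
    Finset.mem_filter.2 ⟨(hkey U hU).1, (hkey U hU).2⟩
  rw [← Finset.sum_fiberwise_of_maps_to hmaps]
  refine Finset.sum_congr rfl fun K hK => ?_
  obtain ⟨hK𝓕, hKfix⟩ := Finset.mem_filter.1 hK
  obtain ⟨hbt, hclass⟩ := hfib K hK𝓕 hKfix
  have hset : 𝓕.filter (fun U => key U = K) = Finset.Icc (bot K) (top K) := by
    ext U
    rw [Finset.mem_filter]
    exact hclass U
  have htop : top K ⊆ l.toFinset := by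
    have hmem : top K ∈ 𝓕 := ((hclass (top K)).2 (Finset.mem_Icc.2 ⟨hbt, subset_rfl⟩)).1
    exact h𝓕 _ hmem
  rw [hset, sum_Icc_orderedNegProd_eq t l hl (bot K) (top K) hbt htop]

/-- Dyson's non-overlapping case with ordered operators (Zimmermann Theorem 3.2 / (3.22)–(3.23) without commutativity): summing the ordered forest
terms over ALL subfamilies of `C` gives the ordered product `Π_{γ∈C} (1 − t_γ)`. [cite: Zimmermann1969, Theorem 3.2, eqs. (3.22)–(3.23)] -/
theorem sum_powerset_orderedNegProd_eq (t : β → R) (l : List β) (hl : l.Nodup) (C : Finset β) (hC : C ⊆ l.toFinset) :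
    ∑ U ∈ C.powerset, orderedNegProd l t U = ((l.filter (· ∈ C)).map fun γ => 1 - t γ).prod := by
  have h := sum_Icc_orderedNegProd_eq t l hl ∅ C (Finset.empty_subset C) hC
  rw [Finset.Icc_eq_filter_powerset] at h
  have hfilter : C.powerset.filter (fun U => (∅ : Finset β) ⊆ U) = C.powerset :=
    Finset.filter_true_of_mem fun U _ => Finset.empty_subset U
  rw [hfilter] at h
  rw [h, orderedClassProd]
  exact congrArg List.prod (List.map_congr_left fun x _ => by simp)

end Literature.MathematicalPhysics.QuantumFieldTheory.Zimmermann1969
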